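import Mathlib
import Summits.Ventures.PercRepro.TriangleCapSquareSumArith
import Summits.Ventures.PercRepro.TriangleCapVertexLeaf
import Summits.Ventures.PercRepro.TriangleCapDeficiency

/-!
# PercRepro — THE SQUARE-SUM BOUND FOR TRIANGLE-FREE GRAPHS WITH BOUNDED DEGREE (p3, gen 55; part 299)

**THEOREM** (`sum_deg_sq_le_sqMax`): every triangle-free graph with `s ≤ D²` edges and every degree `≤ D` has

  **`Σ_v d(v)² ≤ sqMax s D = m D (D + m) + r (r + 2 m + 1)`**   (`s = m D + r`, `r < D`)

— the square sum of the NESTED bipartite configuration (part 298).  Proof by induction on `D`, then on `s`: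
(a) a vertex `w` of degree `D` is deleted — `Σ d² = Σ d′² + D² + D + 2 Σ_{u ∼ w} (d(u) − 1)` (part 190's
`sum_deg_sq_deleteIncidenceSet`) and, the neighbourhood of `w` being independent, its edges are distinct:
`Σ_{u ∼ w} (d(u) − 1) = attach ≤ s − D` (`sum_nbhd_deg_pred_le`); the induction hypothesis at `s − D` and THE
STEP `sqMax s D + D = sqMax (s − D) D + D² + 2 s` close the case EXACTLY; (b) if no vertex has degree `D`, every
degree is `≤ D − 1`: for `s ≤ (D − 1)²` the statement at `D − 1` and THE MONOTONICITY `sqMax s (D − 1) ≤ sqMax s D`,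
otherwise the regular bound `Σ d² ≤ 2 s (D − 1)` and THE REGULAR COMPARISON.  Consequences: the same bound for
the off-degrees of any vertex `w` (the off-edge graph `H.deleteIncidenceSet w`, `sum_offDeg_sq_le_sqMax`) and
THE NESTED LOWER BOUND OF THE BAND `t (t + 1) ≤ 2 j + sqMax t D` for every graph of the band with every
off-degree `≤ D` and `t ≤ D²` (`band_ge_nested`; the identity `2 j = t (t + 1) + 2 |inside| − Σ_v c(v)²`,
`band_eq_of_offDeg_sq`).  Axioms: standard.
-/

namespace PercRepro

namespace TriangleCap

namespace C047

open Finset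

variable {V : Type*} [Fintype V] [DecidableEq V]

/-- `Σ_{u ∼ w} (d(u) − 1) = attach H w`: a neighbour of `w` has degree `1 + offDeg`. -/
theorem sum_nbhd_deg_pred_eq_attach (H : SimpleGraph V) [DecidableRel H.Adj] (w : V) :
    ∑ u ∈ univ.filter (fun u => H.Adj w u), (deg H u - 1) = attach H w := by
  unfold attach
  apply sum_congr rfl
  intro u hu
  rw [mem_filter] at hu
  have hne : u ≠ w := fun h => H.irrefl (h ▸ hu.2)
  rw [deg_eq_boole_add_offDeg H w u hne, if_pos hu.2]
  omega

/-- **THE NEIGHBOURHOOD SUM:** in a triangle-free graph `Σ_{u ∼ w} (d(u) − 1) + d(w) ≤ s` — the neighbourhood of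
`w` is independent, so the edges at its members are distinct. -/
theorem sum_nbhd_deg_pred_le (H : SimpleGraph V) [DecidableRel H.Adj] (hfree : H.CliqueFree 3) (w : V) :
    ∑ u ∈ univ.filter (fun u => H.Adj w u), (deg H u - 1) + deg H w ≤ H.edgeFinset.card := by
  rw [sum_nbhd_deg_pred_eq_attach]
  have h1 := attach_le H hfree w
  have h2 := card_offEdges_add_deg H w
  omega

/-- Deleting the edges at `w` does not increase any degree. -/
theorem deg_deleteIncidenceSet_le (H : SimpleGraph V) [DecidableRel H.Adj] (w v : V) :
    deg (H.deleteIncidenceSet w) v ≤ deg H v := by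
  by_cases hv : v = w
  · rw [hv, deg_deleteIncidenceSet_self]
    exact Nat.zero_le _
  · rw [deg_deleteIncidenceSet H w v hv]
    split_ifs <;> omega

omit [DecidableEq V] in
/-- **THE REGULAR BOUND:** `Σ_v d(v)² ≤ 2 s D` when every degree is `≤ D`. -/
theorem sum_deg_sq_le_regular (H : SimpleGraph V) [DecidableRel H.Adj] (D : ℕ) (hD : ∀ v, deg H v ≤ D) :
    ∑ v, deg H v * deg H v ≤ 2 * (H.edgeFinset.card * D) := by
  have hsum : ∑ v, deg H v = 2 * H.edgeFinset.card := by
    simp_rw [deg_eq_degree]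
    exact H.sum_degrees_eq_twice_card_edges
  calc ∑ v, deg H v * deg H v ≤ ∑ v, deg H v * D := sum_le_sum (fun v _ => Nat.mul_le_mul_left _ (hD v))
    _ = (∑ v, deg H v) * D := by rw [sum_mul]
    _ = 2 * (H.edgeFinset.card * D) := by rw [hsum]; ring

/-- **THE SQUARE-SUM BOUND FOR TRIANGLE-FREE GRAPHS:** every triangle-free graph with `s ≤ D²` edges and every
degree `≤ D` has `Σ_v d(v)² ≤ sqMax s D` — the square sum of the nested configuration. -/
theorem sum_deg_sq_le_sqMax (D : ℕ) : ∀ (s : ℕ) (H : SimpleGraph V) [DecidableRel H.Adj], H.CliqueFree 3 →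
    H.edgeFinset.card = s → (∀ v, deg H v ≤ D) → s ≤ D * D → ∑ v, deg H v * deg H v ≤ sqMax s D := by
  induction D with
  | zero =>
    intro s H _ _ hs hD hsD
    have hs0 : s = 0 := by omega
    subst hs0
    rw [sqMax_zero]
    apply le_of_eq
    apply sum_eq_zero
    intro v _
    have h0 : deg H v = 0 := Nat.le_zero.mp (hD v)
    simp [h0]
  | succ d ih =>
    intro s
    induction s using Nat.strong_induction_on with
    | _ s ihs =>
      intro H _ hfree hs hD hsD
      by_cases hex : ∃ w, deg H w = d + 1
      · -- (a) delete a vertex of degree `d + 1`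
        obtain ⟨w, hw⟩ := hex
        have hfree' : (H.deleteIncidenceSet w).CliqueFree 3 := hfree.anti (H.deleteIncidenceSet_le w)
        have hcard' : (H.deleteIncidenceSet w).edgeFinset.card = s - (d + 1) := by
          rw [SimpleGraph.card_edgeFinset_deleteIncidenceSet, ← deg_eq_degree, hw, hs]
        have hD' : ∀ v, deg (H.deleteIncidenceSet w) v ≤ d + 1 :=
          fun v => (deg_deleteIncidenceSet_le H w v).trans (hD v)
        have hsd : d + 1 ≤ s := by
          have := card_offEdges_add_deg H w
          omega
        have hIH := ihs (s - (d + 1)) (by omega) (H.deleteIncidenceSet w) hfree' hcard' hD' (by omega)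
        have hdec := sum_deg_sq_deleteIncidenceSet H w
        have hnb := sum_nbhd_deg_pred_le H hfree w
        have hstep := sqMax_step s (d + 1) (by omega) hsd
        rw [hw] at hdec hnb
        rw [hs] at hnb
        generalize hq : (d + 1) * (d + 1) = q at hdec hstep
        omega
      · -- (b) every degree is `≤ d`
        have hD' : ∀ v, deg H v ≤ d := fun v => by
          have h1 := hD v
          have h2 : deg H v ≠ d + 1 := fun h => hex ⟨v, h⟩
          omega
        by_cases hsd : s ≤ d * d
        · have h1 := ih s H hfree hs hD' hsd
          have h2 := sqMax_mono s d hsd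
          omega
        · have h1 := sum_deg_sq_le_regular H d hD'
          rw [hs] at h1
          have h2 := sqMax_ge_regular s d (by omega) hsD
          omega

/-- **THE SQUARE SUM OF THE OFF-DEGREES:** `Σ_v offDeg w v² ≤ sqMax t D` for every triangle-free `H`, every
vertex `w` with `t` off-edges, every off-degree `≤ D` and `t ≤ D²` — the off-edge graph `H.deleteIncidenceSet w`
is triangle-free with `t` edges and degrees the off-degrees. -/
theorem sum_offDeg_sq_le_sqMax (H : SimpleGraph V) [DecidableRel H.Adj] (hfree : H.CliqueFree 3) (w : V)
    (t D : ℕ) (ht : (offEdges H w).card = t) (hD : ∀ v, offDeg H w v ≤ D) (htD : t ≤ D * D) :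
    ∑ v, offDeg H w v * offDeg H w v ≤ sqMax t D := by
  have h := sum_deg_sq_le_sqMax D t (H.deleteIncidenceSet w) (hfree.anti (H.deleteIncidenceSet_le w))
    (by rw [card_edgeFinset_deleteIncidenceSet_eq_offEdges, ht])
    (fun v => by rw [deg_deleteIncidenceSet_eq_offDeg]; exact hD v) htD
  simp_rw [deg_deleteIncidenceSet_eq_offDeg] at h
  exact h

/-- **THE BAND VALUE THROUGH THE OFF-DEGREE SQUARES:** `2 j + Σ_v c(v)² = t (t + 1) + 2 |inside|` for a
triangle-free `H` with `s` edges, `w` of degree `s − t ≥ 1`, at the band value `2 j`. -/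
theorem band_eq_of_offDeg_sq (H : SimpleGraph V) [DecidableRel H.Adj] (hfree : H.CliqueFree 3) (s t j : ℕ)
    (hs : H.edgeFinset.card = s) (w : V) (hw : deg H w + t = s) (hw1 : 1 ≤ deg H w)
    (hj : ∑ v, deg H v * deg H v + 2 * (t * (s - t - 1)) + 2 * j = s * (s + 1)) :
    2 * j + ∑ v, offDeg H w v * offDeg H w v = t * (t + 1) + 2 * (insideEdges H w).card := by
  have hdec := sum_deg_sq_vertex_decomposition H w
  have hatt := attach_add_card_inside H hfree w
  have hsq := sum_deg_sq_deleteIncidenceSet_eq_offAdjPairs H w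
  simp_rw [deg_deleteIncidenceSet_eq_offDeg] at hsq
  have hcard := card_offEdges_add_deg H w
  have ht : (offEdges H w).card = t := by omega
  rw [ht] at hdec hatt hsq
  obtain ⟨x, hx⟩ : ∃ x, deg H w = x := ⟨_, rfl⟩
  rw [hx] at hdec hw hw1
  subst hw
  rw [Nat.add_sub_cancel] at hj
  set Q := ∑ v, deg H v * deg H v with hQ
  set S := ∑ v, offDeg H w v * offDeg H w v with hS
  set A := attach H w with hA
  set P := offAdjPairs H w with hP
  set I := (insideEdges H w).card with hI
  have e1 : x - 1 + 1 = x := by omega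
  zify [hw1] at hj hdec hatt hsq ⊢
  linear_combination hj - hdec + hsq - 2 * hatt

/-- **THE NESTED LOWER BOUND OF THE BAND:** `t (t + 1) ≤ 2 j + sqMax t D` for every triangle-free `H` with `s`
edges, `w` of degree `s − t ≥ 1`, every off-degree `≤ D` and `t ≤ D²` — the band value is at least that of the
nested configuration `(D^m, r)` with its conjugate rows. -/
theorem band_ge_nested (H : SimpleGraph V) [DecidableRel H.Adj] (hfree : H.CliqueFree 3) (s t j D : ℕ)
    (hs : H.edgeFinset.card = s) (w : V) (hw : deg H w + t = s) (hw1 : 1 ≤ deg H w)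
    (hj : ∑ v, deg H v * deg H v + 2 * (t * (s - t - 1)) + 2 * j = s * (s + 1))
    (hD : ∀ v, offDeg H w v ≤ D) (htD : t ≤ D * D) : t * (t + 1) ≤ 2 * j + sqMax t D := by
  have hid := band_eq_of_offDeg_sq H hfree s t j hs w hw hw1 hj
  have hle := sum_offDeg_sq_le_sqMax H hfree w t D (by have := card_offEdges_add_deg H w; omega) hD htD
  omega

end C047

end TriangleCap

end PercRepro
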